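import Mathlib.Analysis.Calculus.InverseFunctionTheorem.FDeriv
import Mathlib.Analysis.Normed.Module.FiniteDimension
import Mathlib.Topology.MetricSpace.Pseudo.Lemmas
import HarnessLib

/-!
# Immersed compact pieces are uniformly bi-Lipschitz

Two compactness estimates for a map `G` from a finite-dimensional real normed space `W` which,
on a compact set `S` whose differences lie in a subspace `Dir` (e.g. a closed simplex and its
direction space), is strictly differentiable with continuous derivative injective on `Dir`:

* `exists_pos_forall_mul_norm_le_norm_apply` — the derivative is *uniformly* bounded below on
  `Dir`: `μ ‖u‖ ≤ ‖G' x u‖` for all `x ∈ S`, `u ∈ Dir` (minimum over the compact set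
  `S × (Dir ∩ sphere)`);
* `exists_pos_forall_mul_norm_sub_le` — if moreover `G` is injective on `S`, then `G` is
  uniformly bi-Lipschitz below on `S`: `μ ‖y - y'‖ ≤ ‖G y - G y'‖` (locally from strict
  differentiability, `HasStrictFDerivAt.approximates_deriv_on_nhds`, globally by a Lebesgue
  number argument and the positive minimum of `‖G y - G y'‖` on pairs at distance `≥ δ`).

This is the content of Munkres, *Elementary differential topology* (1966), 8.5–8.6 (an
immersion of a compact piece is locally, hence — if injective — globally, distance-increasing
up to a constant), in the form needed for the fitting together of smooth triangulations.
No named facts are introduced.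
-/

open Set Function Filter Metric
open scoped Topology NNReal

noncomputable section

namespace Literature.Analysis.Calculus

variable {W : Type*} [NormedAddCommGroup W] [NormedSpace ℝ W] [FiniteDimensional ℝ W]
  {V : Type*} [NormedAddCommGroup V] [NormedSpace ℝ V]

/-- **Uniform lower bound for an injective family of derivatives.** If `f' : W → (W →L V)` is
continuous on the compact set `S` and each `f' x`, `x ∈ S`, is injective on the subspace `Dir`,
then `μ ‖u‖ ≤ ‖f' x u‖` for some `μ > 0`, all `x ∈ S` and all `u ∈ Dir`. [folklore] -/
theorem exists_pos_forall_mul_norm_le_norm_apply {f' : W → W →L[ℝ] V} {S : Set W}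
    (hS : IsCompact S) (hf' : ContinuousOn f' S) (Dir : Submodule ℝ W)
    (hinj : ∀ x ∈ S, ∀ u ∈ Dir, f' x u = 0 → u = 0) :
    ∃ μ > 0, ∀ x ∈ S, ∀ u ∈ Dir, μ * ‖u‖ ≤ ‖f' x u‖ := by
  -- the compact set of pairs (point, unit direction)
  set T : Set (W × W) := S ×ˢ ((Dir : Set W) ∩ sphere 0 1) with hT
  have hTc : IsCompact T :=
    hS.prod ((isCompact_sphere 0 1).inter_left (Submodule.closed_of_finiteDimensional Dir))
  have hφ : ContinuousOn (fun p : W × W => ‖f' p.1 p.2‖) T := by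
    refine ContinuousOn.norm ?_
    have h1 : ContinuousOn (fun p : W × W => f' p.1) T := hf'.comp continuous_fst.continuousOn
      fun p hp => hp.1
    exact isBoundedBilinearMap_apply.continuous.comp_continuousOn (h1.prodMk continuous_snd.continuousOn)
  rcases T.eq_empty_or_nonempty with hTe | hTne
  · -- no unit directions over points of `S`: then `Dir`-vectors over `S` vanish, or `S = ∅`
    refine ⟨1, one_pos, fun x hx u hu => ?_⟩
    by_cases hu0 : u = 0
    · simp [hu0]
    · exfalso
      have hmem : (x, ‖u‖⁻¹ • u) ∈ T := by
        refine ⟨hx, Dir.smul_mem _ hu, ?_⟩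
        rw [mem_sphere_zero_iff_norm, norm_smul, norm_inv, norm_norm,
          inv_mul_cancel₀ (norm_ne_zero_iff.2 hu0)]
      rw [hTe] at hmem
      exact hmem
  · obtain ⟨p₀, hp₀, hmin⟩ := hTc.exists_isMinOn hTne hφ
    set μ : ℝ := ‖f' p₀.1 p₀.2‖ with hμ
    have hμpos : 0 < μ := by
      rw [hμ, norm_pos_iff]
      intro h0
      have hu0 := hinj p₀.1 hp₀.1 p₀.2 hp₀.2.1 h0
      have : ‖p₀.2‖ = 1 := mem_sphere_zero_iff_norm.1 hp₀.2.2
      rw [hu0, norm_zero] at this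
      exact zero_ne_one this
    refine ⟨μ, hμpos, fun x hx u hu => ?_⟩
    by_cases hu0 : u = 0
    · simp [hu0]
    · have hnu : ‖u‖ ≠ 0 := norm_ne_zero_iff.2 hu0
      have hmem : (x, ‖u‖⁻¹ • u) ∈ T := by
        refine ⟨hx, Dir.smul_mem _ hu, ?_⟩
        rw [mem_sphere_zero_iff_norm, norm_smul, norm_inv, norm_norm, inv_mul_cancel₀ hnu]
      have hle : μ ≤ ‖f' x (‖u‖⁻¹ • u)‖ := hmin hmem
      rw [map_smul, norm_smul, norm_inv, norm_norm] at hle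
      rwa [le_inv_mul_iff₀ (norm_pos_iff.2 hu0), mul_comm] at hle

/-- **Injective immersed compact pieces are uniformly bi-Lipschitz** (Munkres (1966), 8.5–8.6).
Let `S` be compact with differences in the subspace `Dir`, let `G` be strictly differentiable at
the points of `S` with derivative `G'` continuous on `S` and injective on `Dir`, and let `G` be
injective on `S`. Then `μ ‖y - y'‖ ≤ ‖G y - G y'‖` on `S` for some `μ > 0`.
[cite: Munkres1966, 8.5–8.6] -/
theorem exists_pos_forall_mul_norm_sub_le {G : W → V} {G' : W → W →L[ℝ] V} {S : Set W}
    (hS : IsCompact S) {Dir : Submodule ℝ W} (hSDir : ∀ y ∈ S, ∀ y' ∈ S, y - y' ∈ Dir)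
    (hG : ∀ x ∈ S, HasStrictFDerivAt G (G' x) x) (hcont : ContinuousOn G' S)
    (hinjD : ∀ x ∈ S, ∀ u ∈ Dir, G' x u = 0 → u = 0) (hinj : InjOn G S) :
    ∃ μ > 0, ∀ y ∈ S, ∀ y' ∈ S, μ * ‖y - y'‖ ≤ ‖G y - G y'‖ := by
  obtain ⟨μ₀, hμ₀, hlow⟩ := exists_pos_forall_mul_norm_le_norm_apply hS hcont Dir hinjD
  -- local estimate from strict differentiability
  have hc : (0 : ℝ≥0) < ⟨μ₀ / 2, by positivity⟩ := by
    show (0 : ℝ) < μ₀ / 2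
    positivity
  have hloc : ∀ x ∈ S, ∃ U : Set W, IsOpen U ∧ x ∈ U ∧
      ∀ y ∈ U, ∀ y' ∈ U, ‖G y - G y' - G' x (y - y')‖ ≤ μ₀ / 2 * ‖y - y'‖ := by
    intro x hx
    obtain ⟨s, hs, happ⟩ := (hG x hx).approximates_deriv_on_nhds (c := ⟨μ₀ / 2, by positivity⟩)
      (Or.inr hc)
    obtain ⟨U, hUs, hUo, hxU⟩ := _root_.mem_nhds_iff.1 hs
    exact ⟨U, hUo, hxU, fun y hy y' hy' => happ y (hUs hy) y' (hUs hy')⟩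
  choose! U hUo hxU hU using hloc
  obtain ⟨δ, hδ, hleb⟩ := lebesgue_number_lemma_of_metric hS (c := fun x : S => U x)
    (fun x => hUo x x.2) (fun x hx => mem_iUnion.2 ⟨⟨x, hx⟩, hxU x hx⟩)
  -- `G` is continuous on `S`
  have hGc : ContinuousOn G S := fun x hx => (hG x hx).continuousAt.continuousWithinAt
  -- close pairs
  have hclose : ∀ y ∈ S, ∀ y' ∈ S, dist y' y < δ → μ₀ / 2 * ‖y - y'‖ ≤ ‖G y - G y'‖ := by
    intro y hy y' hy' hd
    obtain ⟨⟨x, hx⟩, hball⟩ := hleb y hy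
    have hyU : y ∈ U x := hball (mem_ball_self hδ)
    have hy'U : y' ∈ U x := hball (mem_ball.2 hd)
    have h1 := hU x hx y hyU y' hy'U
    have h2 : μ₀ * ‖y - y'‖ ≤ ‖G' x (y - y')‖ := hlow x hx (y - y') (hSDir y hy y' hy')
    have h3 : ‖G' x (y - y')‖ ≤ ‖G y - G y'‖ + ‖G y - G y' - G' x (y - y')‖ :=
      calc ‖G' x (y - y')‖ = ‖(G y - G y') - (G y - G y' - G' x (y - y'))‖ := by
            congr 1; abel
        _ ≤ ‖G y - G y'‖ + ‖G y - G y' - G' x (y - y')‖ := norm_sub_le _ _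
    linarith
  -- a bound for the diameter of `S`
  obtain ⟨R, hR⟩ := hS.isBounded.exists_norm_le
  set D : ℝ := 2 * |R| + 1 with hD
  have hDpos : 0 < D := by positivity
  have hdiam : ∀ y ∈ S, ∀ y' ∈ S, ‖y - y'‖ ≤ D := fun y hy y' hy' =>
    calc ‖y - y'‖ ≤ ‖y‖ + ‖y'‖ := norm_sub_le _ _
      _ ≤ |R| + |R| := add_le_add ((hR y hy).trans (le_abs_self R)) ((hR y' hy').trans (le_abs_self R))
      _ ≤ D := by rw [hD]; linarith
  -- far pairs: positive minimum of `‖G y - G y'‖`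
  set P : Set (W × W) := (S ×ˢ S) ∩ {p | δ ≤ dist p.2 p.1} with hP
  have hPc : IsCompact P :=
    (hS.prod hS).inter_right (isClosed_le continuous_const (continuous_snd.dist continuous_fst))
  have hψ : ContinuousOn (fun p : W × W => ‖G p.1 - G p.2‖) P :=
    ((hGc.comp continuous_fst.continuousOn fun p hp => hp.1.1).sub
      (hGc.comp continuous_snd.continuousOn fun p hp => hp.1.2)).norm
  obtain ⟨m₁, hm₁, hfar⟩ : ∃ m₁ > 0, ∀ p ∈ P, m₁ ≤ ‖G p.1 - G p.2‖ := by
    rcases P.eq_empty_or_nonempty with hPe | hPne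
    · exact ⟨1, one_pos, fun p hp => by rw [hPe] at hp; exact hp.elim⟩
    · obtain ⟨p₁, hp₁, hmin⟩ := hPc.exists_isMinOn hPne hψ
      refine ⟨‖G p₁.1 - G p₁.2‖, ?_, fun p hp => hmin hp⟩
      rw [gt_iff_lt, norm_pos_iff, sub_ne_zero]
      intro heq
      have hne : p₁.1 ≠ p₁.2 := by
        intro h
        have : δ ≤ dist p₁.2 p₁.1 := hp₁.2
        rw [h, dist_self] at this
        exact not_lt.2 this hδ
      exact hne (hinj hp₁.1.1 hp₁.1.2 heq)
  -- conclusion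
  refine ⟨min (μ₀ / 2) (m₁ / D), lt_min (by positivity) (by positivity), fun y hy y' hy' => ?_⟩
  by_cases hd : dist y' y < δ
  · exact (mul_le_mul_of_nonneg_right (min_le_left _ _) (norm_nonneg _)).trans
      (hclose y hy y' hy' hd)
  · have hp : (y, y') ∈ P := ⟨⟨hy, hy'⟩, not_lt.1 hd⟩
    calc min (μ₀ / 2) (m₁ / D) * ‖y - y'‖ ≤ (m₁ / D) * D :=
          mul_le_mul (min_le_right _ _) (hdiam y hy y' hy') (norm_nonneg _) (by positivity)
      _ = m₁ := by field_simp
      _ ≤ ‖G y - G y'‖ := hfar (y, y') hp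

end Literature.Analysis.Calculus
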